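import Literature.NumberTheory.Sieve.HeathBrownWeightFourthMoment
import HarnessLib

/-! # RomanoffHeathBrown — tools for the assembly (helpers for item stmt-Parity-20276 `Assembly`
of `route-Parity-RomanoffHeathBrown`)

The elementary inputs of Romanoff's Cauchy–Schwarz step for `P + A`, `A` = the Heath-Brown primes:
* Chebyshev's elementary lower bound `ϑ(N) ≥ N/2 + log 2` for large `N` (Mathlib
  `Chebyshev.theta_ge`), hence `∑_{odd p ≤ N} log p ≥ N/2` and the first moment
  `∑_{n ≤ 2N} R(n) ≥ (N/2) U`, `R(n) = ∑_k u(k) θ_N(n − k)`, `U = ∑_k u(k)`;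
* the regime lemma `(N log N)(N^{1/3} log N (ηX + 2)) ≤ η² N²` for large `N` (the diagonal of the
  second moment is negligible: `(log N)^{2+2c} = o(N^{1/3})`);
* the support lemma: `u(k) θ_N(n − k) ≠ 0` forces `n = p + (x³ + 2y³)` even, with `p` and
  `x³ + 2y³` prime, `x, y ≥ 1`.
Sources: [Nathanson1996] (§7.6, Romanoff's theorem), [HeathBrownActa2001] (Theorem 1). -/

noncomputable section

open Finset Filter Asymptotics
open scoped Topology

namespace Summit.Parity.GeneralizedHardyLittlewood.Theses.RomanoffHeathBrown

open Literature.NumberTheory.Sieve Literature.NumberTheory.Sieve.CubicPrimes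
open Literature.NumberTheory.Sieve.CubicMinorant

/-! ## Chebyshev's lower bound and the first moment -/

/-- **Chebyshev, elementary**: `ϑ(N) ≥ N/2 + log 2` for all large `N`, from Mathlib's
`Chebyshev.theta_ge` (`ϑ(n) ≥ n log 2 − log(n+1) − 2√n log n`) and `log x = o(√x)`. [folklore] -/
theorem eventually_theta_ge_half :
    ∀ᶠ N : ℕ in atTop, (N : ℝ) / 2 + Real.log 2 ≤ Chebyshev.theta N := by
  have h1 : ∀ᶠ x : ℝ in atTop, ‖Real.log x‖ ≤ 1 / 100 * ‖x ^ ((1 : ℝ) / 2)‖ :=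
    (isLittleO_log_rpow_atTop (by norm_num : (0 : ℝ) < 1 / 2)).bound (by norm_num)
  have h2 : ∀ᶠ x : ℝ in atTop, ‖Real.log x‖ ≤ 1 / 100 * ‖x ^ (1 : ℝ)‖ :=
    (isLittleO_log_rpow_atTop (by norm_num : (0 : ℝ) < 1)).bound (by norm_num)
  filter_upwards [tendsto_natCast_atTop_atTop.eventually h1,
    tendsto_natCast_atTop_atTop.eventually h2, eventually_ge_atTop 5] with N hN1 hN2 hN5
  have hN0 : (0 : ℝ) ≤ N := Nat.cast_nonneg N
  have h5 : (5 : ℝ) ≤ N := by exact_mod_cast hN5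
  have hlog0 : 0 ≤ Real.log N := Real.log_natCast_nonneg N
  rw [Real.norm_of_nonneg hlog0, Real.norm_of_nonneg (Real.rpow_nonneg hN0 _),
    ← Real.sqrt_eq_rpow] at hN1
  rw [Real.norm_of_nonneg hlog0, Real.norm_of_nonneg (Real.rpow_nonneg hN0 _),
    Real.rpow_one] at hN2
  have hth := Chebyshev.theta_ge N
  have hsq : Real.sqrt N * Real.sqrt N = N := Real.mul_self_sqrt hN0
  have hs0 : 0 ≤ Real.sqrt N := Real.sqrt_nonneg N
  have hA : 2 * Real.sqrt N * Real.log N ≤ (N : ℝ) / 50 := by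
    calc 2 * Real.sqrt N * Real.log N ≤ 2 * Real.sqrt N * (1 / 100 * Real.sqrt N) :=
          mul_le_mul_of_nonneg_left hN1 (by positivity)
      _ = Real.sqrt N * Real.sqrt N / 50 := by ring
      _ = (N : ℝ) / 50 := by rw [hsq]
  have hB : Real.log ((N : ℝ) + 1) ≤ (N : ℝ) / 50 := by
    have hsq2 : (N : ℝ) + 1 ≤ (N : ℝ) ^ 2 := by nlinarith
    calc Real.log ((N : ℝ) + 1) ≤ Real.log ((N : ℝ) ^ 2) := Real.log_le_log (by linarith) hsq2
      _ = 2 * Real.log N := by rw [Real.log_pow]; norm_num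
      _ ≤ (N : ℝ) / 50 := by linarith
  have hl2' : 0.6931471803 < Real.log 2 := Real.log_two_gt_d9
  have hl2 : Real.log 2 < 0.6931471808 := Real.log_two_lt_d9
  have hNl : 0.6931471803 * (N : ℝ) ≤ (N : ℝ) * Real.log 2 := by nlinarith
  linarith

/-- **The odd primes carry `ϑ(N) − log 2`**: if `ϑ(N) ≥ N/2 + log 2` then
`∑_{1 ≤ m ≤ N} θ_N(m) ≥ N/2`, `θ_N = log` on the odd primes `≤ N` (else `0`). [folklore] -/
theorem sum_thetaN_ge {N : ℕ} (hθ : (N : ℝ) / 2 + Real.log 2 ≤ Chebyshev.theta N) :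
    (N : ℝ) / 2 ≤ ∑ m ∈ Icc 1 N, (if m.Prime ∧ Odd m ∧ m ≤ N then Real.log (m : ℝ) else 0) := by
  have hset : (Icc 1 N).filter (fun m : ℕ => m.Prime ∧ Odd m ∧ m ≤ N) =
      (Nat.primesLE N).filter (fun p : ℕ => Odd p) := by
    ext m
    simp only [mem_filter, mem_Icc, Nat.mem_primesLE]
    constructor
    · rintro ⟨⟨-, h2⟩, hp, ho, -⟩; exact ⟨⟨h2, hp⟩, ho⟩
    · rintro ⟨⟨h2, hp⟩, ho⟩; exact ⟨⟨hp.one_lt.le, h2⟩, hp, ho, h2⟩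
  have hsplit := Finset.sum_filter_add_sum_filter_not (Nat.primesLE N) (fun p : ℕ => Odd p)
    (fun p : ℕ => Real.log p)
  rw [← Chebyshev.theta_eq_sum_primesLE_log] at hsplit
  have hnotodd : ∑ p ∈ (Nat.primesLE N).filter (fun p : ℕ => ¬ Odd p), Real.log p ≤ Real.log 2 := by
    calc ∑ p ∈ (Nat.primesLE N).filter (fun p : ℕ => ¬ Odd p), Real.log p
        ≤ ∑ p ∈ ({2} : Finset ℕ), Real.log p := by
          refine Finset.sum_le_sum_of_subset_of_nonneg (fun p hp => ?_)
            (fun p _ _ => Real.log_natCast_nonneg p)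
          obtain ⟨hp, hno⟩ := mem_filter.mp hp
          rw [mem_singleton]
          exact (Nat.mem_primesLE.mp hp).2.eq_two_or_odd'.resolve_right hno
      _ = Real.log 2 := by simp
  rw [← Finset.sum_filter, hset]
  linarith

/-- **The first moment**: `∑_{n ≤ 2N} ∑_{k ≤ N} u(k) θ_N(n − k) ≥ (N/2) · U` for a weight `u ≥ 0`
on `[1, N]`, once `ϑ(N) ≥ N/2 + log 2` (every `k ≤ N` sees all odd primes `m ≤ N` at `n = k + m ≤ 2N`).
[cite: Nathanson1996, §7.6 (proof of Romanoff's theorem)] -/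
theorem first_moment_ge {N : ℕ} (hθ : (N : ℝ) / 2 + Real.log 2 ≤ Chebyshev.theta N)
    {u : ℕ → ℝ} (hu : ∀ k, 0 ≤ u k) :
    (N : ℝ) / 2 * ∑ k ∈ Icc 1 N, u k ≤
      ∑ n ∈ Icc 1 (2 * N), ∑ k ∈ Icc 1 N,
        u k * (if (n - k).Prime ∧ Odd (n - k) ∧ n - k ≤ N then Real.log ((n - k : ℕ) : ℝ) else 0) := by
  set θ : ℕ → ℝ := fun m => if m.Prime ∧ Odd m ∧ m ≤ N then Real.log (m : ℝ) else 0 with hθdef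
  have hθ0 : ∀ m, 0 ≤ θ m := fun m => by
    simp only [hθdef]; split_ifs
    · exact Real.log_natCast_nonneg m
    · exact le_rfl
  have hΘ : (N : ℝ) / 2 ≤ ∑ m ∈ Icc 1 N, θ m := sum_thetaN_ge hθ
  show (N : ℝ) / 2 * ∑ k ∈ Icc 1 N, u k ≤ ∑ n ∈ Icc 1 (2 * N), ∑ k ∈ Icc 1 N, u k * θ (n - k)
  rw [Finset.sum_comm, Finset.mul_sum]
  refine Finset.sum_le_sum fun k hk => ?_
  rw [mem_Icc] at hk
  rw [← Finset.mul_sum, mul_comm]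
  refine mul_le_mul_of_nonneg_left (hΘ.trans ?_) (hu k)
  calc ∑ m ∈ Icc 1 N, θ m = ∑ n ∈ (Icc 1 N).image (fun m => m + k), θ (n - k) := by
        rw [Finset.sum_image fun m _ m' _ h => by simpa using h]
        exact Finset.sum_congr rfl fun m _ => by rw [Nat.add_sub_cancel]
    _ ≤ ∑ n ∈ Icc 1 (2 * N), θ (n - k) :=
        Finset.sum_le_sum_of_subset_of_nonneg (fun n hn => by
          obtain ⟨m, hm, rfl⟩ := Finset.mem_image.mp hn
          rw [mem_Icc] at hm ⊢; omega) (fun n _ _ => hθ0 _)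

/-! ## The diagonal is negligible -/

/-- **Regime lemma**: `(N log N) · (N^{1/3} log N (ηX + 2)) ≤ η² N²` for all large `N`
(`X ≤ N^{1/3}`, `η ≤ 1`, `η² ≥ (log N)^{−2c}`, and `(log N)^{2+2c} ≤ N^{1/3}/2` eventually).
[cite: HeathBrownActa2001, Theorem 1 (the box X < x, y ≤ X(1+η) with η = (log X)^{-c})] -/
theorem eventually_diag_le {c : ℝ} (hc : 0 < c) :
    ∀ᶠ N : ℕ in atTop, ((N : ℝ) * Real.log N) *
        ((N : ℝ) ^ ((1 : ℝ) / 3) * Real.log N * (hbEta c N * hbX N + 2)) ≤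
      hbEta c N ^ 2 * N * N := by
  have ho := (isLittleO_log_rpow_rpow_atTop (2 + 2 * c) (by norm_num : (0 : ℝ) < 1 / 3)).bound
    (by norm_num : (0 : ℝ) < 1 / 2)
  have hη1 : ∀ᶠ N : ℕ in atTop, hbEta c N ≤ 1 :=
    (tendsto_hbEta hc).eventually (eventually_le_nhds one_pos)
  filter_upwards [tendsto_natCast_atTop_atTop.eventually ho, hη1, eventually_gt_atTop 8]
    with N hN hη hN8
  obtain ⟨hX1, hLX, hLXle⟩ := hbX_facts (show 6 < N by omega)
  have hN0 : (0 : ℝ) < N := by exact_mod_cast (show 0 < N by omega)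
  have hL : 0 < Real.log N := Real.log_pos (by exact_mod_cast (show 1 < N by omega))
  have hN13 : 0 < (N : ℝ) ^ ((1 : ℝ) / 3) := by positivity
  rw [Real.norm_of_nonneg (Real.rpow_nonneg hL.le _), Real.norm_of_nonneg hN13.le] at hN
  -- `η² ≥ (log N)^{-2c}`
  have hηsq : Real.log N ^ (-(2 * c)) ≤ hbEta c N ^ 2 := by
    have hsq : hbEta c N ^ 2 = Real.log (hbX N) ^ (-(2 * c)) := by
      unfold hbEta
      rw [← Real.rpow_natCast, ← Real.rpow_mul hLX.le]
      congr 1; push_cast; ring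
    rw [hsq]
    exact Real.rpow_le_rpow_of_nonpos hLX hLXle (by linarith)
  -- `X ≤ N^{1/3}`, `2 ≤ N^{1/3}`
  have hX : hbX N ≤ (N : ℝ) ^ ((1 : ℝ) / 3) := by
    unfold hbX
    exact Real.rpow_le_rpow (by positivity) (by linarith) (by norm_num)
  have hcube : ((N : ℝ) ^ ((1 : ℝ) / 3)) ^ 3 = N := by
    rw [← Real.rpow_natCast, ← Real.rpow_mul hN0.le]; norm_num
  have h2 : (2 : ℝ) ≤ (N : ℝ) ^ ((1 : ℝ) / 3) := by
    by_contra h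
    push Not at h
    have h' : ((N : ℝ) ^ ((1 : ℝ) / 3)) ^ 3 < 2 ^ 3 := by gcongr
    rw [hcube] at h'
    have h8 : (8 : ℝ) < N := by exact_mod_cast hN8
    norm_num at h'
    linarith
  have hηX : hbEta c N * hbX N + 2 ≤ 2 * (N : ℝ) ^ ((1 : ℝ) / 3) := by
    have : hbEta c N * hbX N ≤ 1 * hbX N := mul_le_mul_of_nonneg_right hη (hbX_nonneg N)
    linarith
  -- `(log N)^{2+2c} = (log N)² (log N)^{2c}`
  have hP : 0 < Real.log N ^ (2 * c) := Real.rpow_pos_of_pos hL _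
  have hLsplit : Real.log N ^ (2 + 2 * c) = Real.log N ^ 2 * Real.log N ^ (2 * c) := by
    rw [Real.rpow_add hL, Real.rpow_two]
  have hneg : Real.log N ^ (-(2 * c)) = (Real.log N ^ (2 * c))⁻¹ := Real.rpow_neg hL.le _
  rw [hLsplit] at hN
  -- `(log N)² ≤ N^{1/3} (log N)^{-2c} / 2`
  have hL2 : Real.log N ^ 2 ≤ (N : ℝ) ^ ((1 : ℝ) / 3) * (Real.log N ^ (2 * c))⁻¹ / 2 := by
    rw [le_div_iff₀ (by norm_num : (0 : ℝ) < 2), ← div_eq_mul_inv, le_div_iff₀ hP]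
    linarith
  calc ((N : ℝ) * Real.log N) * ((N : ℝ) ^ ((1 : ℝ) / 3) * Real.log N * (hbEta c N * hbX N + 2))
      ≤ ((N : ℝ) * Real.log N) * ((N : ℝ) ^ ((1 : ℝ) / 3) * Real.log N * (2 * (N : ℝ) ^ ((1 : ℝ) / 3))) :=
        mul_le_mul_of_nonneg_left (mul_le_mul_of_nonneg_left hηX (by positivity)) (by positivity)
    _ = 2 * Real.log N ^ 2 * ((N : ℝ) ^ ((1 : ℝ) / 3)) ^ 2 * N := by ring
    _ ≤ 2 * ((N : ℝ) ^ ((1 : ℝ) / 3) * (Real.log N ^ (2 * c))⁻¹ / 2) *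
          ((N : ℝ) ^ ((1 : ℝ) / 3)) ^ 2 * N := by gcongr
    _ = (Real.log N ^ (2 * c))⁻¹ * ((N : ℝ) ^ ((1 : ℝ) / 3)) ^ 3 * N := by ring
    _ = Real.log N ^ (-(2 * c)) * N * N := by rw [hcube, hneg]
    _ ≤ hbEta c N ^ 2 * N * N := by gcongr

/-! ## The support of `R` -/

/-- **Support lemma**: a non-zero term `u(k) θ_N(n − k)` exhibits `n = p + (x³ + 2y³)` with `p = n − k`
an odd prime and `k = x³ + 2y³` a Heath-Brown prime (`x, y > X ≥ 0`), so `n` is even and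
represented. [cite: HeathBrownActa2001, §2 (2.2)] -/
theorem rep_of_term_ne_zero {c : ℝ} {N n k : ℕ}
    (h : hbWeight c N k *
      (if (n - k).Prime ∧ Odd (n - k) ∧ n - k ≤ N then Real.log ((n - k : ℕ) : ℝ) else 0) ≠ 0) :
    Even n ∧ ∃ p x y : ℕ, 0 < x ∧ 0 < y ∧ p.Prime ∧ (x ^ 3 + 2 * y ^ 3).Prime ∧
      p + (x ^ 3 + 2 * y ^ 3) = n := by
  obtain ⟨hu, hθ⟩ := mul_ne_zero_iff.mp h
  have hcond : (n - k).Prime ∧ Odd (n - k) ∧ n - k ≤ N := by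
    by_contra hc
    exact hθ (if_neg hc)
  obtain ⟨hp, hodd, -⟩ := hcond
  have hrep : hbRep c N k ≠ 0 := by
    intro h0
    apply hu
    simp [hbWeight, h0]
  unfold hbRep at hrep
  obtain ⟨⟨x, y⟩, hxy⟩ := Finset.card_ne_zero.mp hrep
  rw [mem_filter] at hxy
  obtain ⟨hmem, hval⟩ := hxy
  obtain ⟨hx1, -, hy1, -, -, hprime⟩ := mem_primePairs_iff.mp hmem
  have hX := hbX_nonneg N
  have hx0 : 0 < x := by
    have : (0 : ℝ) < x := hX.trans_lt hx1
    exact_mod_cast this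
  have hy0 : 0 < y := by
    have : (0 : ℝ) < y := hX.trans_lt hy1
    exact_mod_cast this
  simp only at hval
  have hx3 : 1 ≤ x ^ 3 := Nat.one_le_pow _ _ hx0
  have hy3 : 1 ≤ y ^ 3 := Nat.one_le_pow _ _ hy0
  have hkodd : Odd k := by
    rw [← hval]
    exact hprime.odd_of_ne_two (by omega)
  have hkn : k ≤ n := by have := hp.two_le; omega
  refine ⟨?_, n - k, x, y, hx0, hy0, hp, hprime, by rw [hval]; omega⟩
  have e : n = (n - k) + k := by omega
  rw [e]
  exact hodd.add_odd hkodd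

/-- **The support of `R` lies in the target set**: if `R(n) = ∑_k u(k) θ_N(n−k) ≠ 0` then `n` is an
even number of the form `p + (x³ + 2y³)`. [cite: Nathanson1996, §7.6 (proof of Romanoff's theorem)] -/
theorem rep_of_sum_ne_zero {c : ℝ} {N n : ℕ}
    (h : ∑ k ∈ Icc 1 N, hbWeight c N k *
      (if (n - k).Prime ∧ Odd (n - k) ∧ n - k ≤ N then Real.log ((n - k : ℕ) : ℝ) else 0) ≠ 0) :
    Even n ∧ ∃ p x y : ℕ, 0 < x ∧ 0 < y ∧ p.Prime ∧ (x ^ 3 + 2 * y ^ 3).Prime ∧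
      p + (x ^ 3 + 2 * y ^ 3) = n := by
  obtain ⟨k, -, hk⟩ := Finset.exists_ne_zero_of_sum_ne_zero h
  exact rep_of_term_ne_zero hk

/-! ## Cauchy–Schwarz on the support -/

/-- **Cauchy–Schwarz on the support**: `(∑_{n ∈ T} R(n))² ≤ #{n ∈ T : R(n) ≠ 0} · ∑_{n ∈ T} R(n)²`
for `R ≥ 0`... in fact for any real `R`. [folklore] -/
theorem sq_sum_le_card_support_mul_sum_sq (T : Finset ℕ) (R : ℕ → ℝ) :
    (∑ n ∈ T, R n) ^ 2 ≤ #(T.filter (fun n => R n ≠ 0)) * ∑ n ∈ T, R n ^ 2 := by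
  set S := T.filter (fun n => R n ≠ 0) with hS
  have h1 : ∑ n ∈ T, R n = ∑ n ∈ S, 1 * R n := by
    rw [hS]; simp only [one_mul]; rw [Finset.sum_filter_ne_zero]
  have h2 : ∑ n ∈ S, R n ^ 2 ≤ ∑ n ∈ T, R n ^ 2 :=
    Finset.sum_le_sum_of_subset_of_nonneg (Finset.filter_subset _ _) fun n _ _ => sq_nonneg _
  calc (∑ n ∈ T, R n) ^ 2 = (∑ n ∈ S, 1 * R n) ^ 2 := by rw [h1]
    _ ≤ (∑ n ∈ S, (1 : ℝ) ^ 2) * ∑ n ∈ S, R n ^ 2 := Finset.sum_mul_sq_le_sq_mul_sq S _ _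
    _ = #S * ∑ n ∈ S, R n ^ 2 := by simp
    _ ≤ #S * ∑ n ∈ T, R n ^ 2 := mul_le_mul_of_nonneg_left h2 (Nat.cast_nonneg _)

end Summit.Parity.GeneralizedHardyLittlewood.Theses.RomanoffHeathBrown

end
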